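import Summits.CriticalPhenomena.PercolationContinuityZ3.Theorems.PercNearOneGluingNoHeavyLowerTailMajorityGluingQCertSevenFive116Q2
import HarnessLib

/-!
# The `(7,5)` certificate with constant `29/25`: quadratic check, part 3 and `sevenFive116_check` (lane prim-rate, constants-miner 1, gen 35; CANDIDATES §GEN-35)

Support file for the closed crux `NoHeavyLowerTail` (stmt-CriticalPhenomena-4575), majority-gluing line.  Chunks of `sevenFive116.checkQ` by `decide +kernel` (`maxHeartbeats 0` scoped to the closed evaluations); the last part assembles `sevenFive116_checkQ` (`checkQ_append`) and **`sevenFive116_check`**.  No sorries.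
-/

namespace Summit.CriticalPhenomena.PercolationContinuityZ3.Theorems

namespace HubOnly
namespace QCert

set_option maxHeartbeats 0 in
/-- The quadratic check passes on the variable rows `[96, 120)`. -/
theorem sevenFive116_checkQ_96 : sevenFive116.checkQ 96 120 = true := by decide +kernel

set_option maxHeartbeats 0 in
/-- The quadratic check passes on the variable rows `[120, 129)`. -/
theorem sevenFive116_checkQ_120 : sevenFive116.checkQ 120 129 = true := by decide +kernel

/-- The quadratic check passes on all `129` variable rows. -/
theorem sevenFive116_checkQ : sevenFive116.checkQ 0 sevenFive116.NV = true :=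
  sevenFive116.checkQ_append (sevenFive116.checkQ_append (sevenFive116.checkQ_append (sevenFive116.checkQ_append (sevenFive116.checkQ_append (sevenFive116_checkQ_0) sevenFive116_checkQ_24) sevenFive116_checkQ_48) sevenFive116_checkQ_72) sevenFive116_checkQ_96) sevenFive116_checkQ_120

/-- **THE `(7,5)` `29/25` CERTIFICATE PASSES.** -/
theorem sevenFive116_check : sevenFive116.check = true := by
  rw [Cert.check, sevenFive116_checkW, sevenFive116_checkQ, Bool.true_and]

end QCert
end HubOnly

end Summit.CriticalPhenomena.PercolationContinuityZ3.Theorems
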